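import Summits.AtomisticToContinuum.HydrodynamicLimit.Theorems.LambertianContactSwapContactAngleEquidistributionEqMomentClusterAutonomy
import Summits.AtomisticToContinuum.HydrodynamicLimit.Theorems.LambertianContactSwapContactAngleEquidistributionEqMomentClusterVirial
import HarnessLib

/-!
# The weighted collision count of an energy block of a hard-sphere orbit over a short window

Brick `stub_eqMomentClusterBound` (registered sub-goal) toward the stub `stub_eqMoment` of the line
`Sketch` of the crux `ContactAngleEquidistribution` (stmt-AtomisticToContinuum-12097, route
LambertianContactSwap): the packaging of `…EqMomentClusterAutonomy` (energy-separated blocks of a good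
torus orbit are autonomous during `[a, b]`, with block speed bound `√(2E_block)` and displacement bound)
and `…EqMomentClusterVirial` (pathwise Clausius virial of an autonomous chart-safe cluster).  For a
labelling `cl` of the particles that is energy-separated at the window start `a`, and a block that is
chart-safe about a base point `c` with margin `(b - a) √(2E)` at time `a`, the collision sum over
`(a, b]` of the post-collisional normal relative velocities `⟪x_i - x_j, v_i⁺ - v_j⁺⟫ > 0` of the
collisions inside the block is at most `(#block) · √(2E_block(a))` (`stub_eqMomentClusterBound`) — a
STATIC functional of the configuration at the window start, polynomial in the block size and with all
moments under the Gibbs law; summed over the blocks, the FULL weighted collision count of the window is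
at most `Σ_i √(2E_{block(i)}(a))` when every block is chart-safe
(`weightedCollisionSum_le_sum_sqrt_blockEnergy`) — what the stationarity argument for the
(momentum-transfer weighted) second moment consumes.  Auxiliary: the chart persists during the window
(`chart_of_chart_initial`), and the `|S| u` form of the virial bound (`clusterCollisionSum_le_card_mul`).

References: I. Gallagher, L. Saint-Raymond, B. Texier, *From Newton to Boltzmann*, EMS (2013), §4.1
[GST2013]; R. K. Alexander, *The infinite hard sphere system*, Ph.D. thesis, Berkeley (1975)
[Alexander1975] (cluster dynamics).
-/

noncomputable section

open MeasureTheory Filter Set Topology Function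
open scoped ENNReal InnerProductSpace BigOperators Classical

namespace Summit.AtomisticToContinuum.HydrodynamicLimit.Theorems.ContactAngleEquidistributionSketch

open Literature.Analysis.FluidPDE Literature.MathematicalPhysics.KineticTheory

variable {d : Type*} [Fintype d] {N : ℕ} {ε : ℝ}

/-! ## Packaging: the weighted collision count of an energy block over a short window -/

section Bound

/-- **The chart persists during the window**: if at time `a` the particles of `S` are within
`1/4 - u (b - a)` of `c` and have speeds `≤ u` on `[a, b]`, they stay within `1/4` of `c` on `[a, b]`
(displacement `≤ u (t - a)`, `euclidDist_flow_le_of_norm_vel_le`). [folklore] -/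
theorem chart_of_chart_initial (Φ : HardSphereFlow (Torus.geometry d) ε N)
    {z : Config N d (UnitAddTorus d)} (hz : z ∈ Φ.good) (S : Finset (Fin N)) (c : UnitAddTorus d)
    {a b u : ℝ} (hu : ∀ t ∈ Icc a b, ∀ k ∈ S, ‖(Φ.flow t z k).2‖ ≤ u)
    (hchart₀ : ∀ k ∈ S, Torus.euclidDist (Φ.flow a z k).1 c + u * (b - a) < 1 / 4) :
    ∀ t ∈ Icc a b, ∀ k ∈ S, Torus.euclidDist (Φ.flow t z k).1 c < 1 / 4 := by
  intro t ht k hk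
  have hdisp := euclidDist_flow_le_of_norm_vel_le Φ hz k ht.1
    fun s hs => hu s ⟨hs.1, hs.2.le.trans ht.2⟩ k hk
  have hu0 : 0 ≤ u := (norm_nonneg _).trans (hu a ⟨le_rfl, ht.1.trans ht.2⟩ k hk)
  have hmono : u * (t - a) ≤ u * (b - a) := mul_le_mul_of_nonneg_left (by linarith [ht.2]) hu0
  linarith [hchart₀ k hk, torus_euclidDist_triangle (Φ.flow t z k).1 (Φ.flow a z k).1 c]

/-- **The weighted collision count of an autonomous chart-safe cluster is at most `|S| u`.**  Under
the hypotheses of `stub_eqMomentClusterVirial`, the collision sum of the normal relative velocities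
`⟪x_i - x_j, v_i⁺ - v_j⁺⟫` (ordered pairs inside `S`, window `(a, b]`) is at most `S.card * u`
(`|G_S| ≤ (1/4) Σ_{k ∈ S} ‖v_k‖ ≤ |S| u / 4` at both ends, `abs_clusterVirial_le`). [folklore] -/
theorem clusterCollisionSum_le_card_mul (Φ : HardSphereFlow (Torus.geometry d) ε N)
    {z : Config N d (UnitAddTorus d)} (hz : z ∈ Φ.good) (S : Finset (Fin N)) (c : UnitAddTorus d)
    {a b u : ℝ} (hab : a ≤ b)
    (haut : ∀ s ∈ collisionTimes (Torus.geometry d) ε (fun t => Φ.flow t z) ∩ Ioc a b, ∀ i j,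
      i ≠ j → Φ.flow s z ∈ contactSet (Torus.geometry d) N ε i j → (i ∈ S ↔ j ∈ S))
    (hchart : ∀ t ∈ Icc a b, ∀ k ∈ S, Torus.euclidDist (Φ.flow t z k).1 c < 1 / 4)
    (hu : ∀ t ∈ Icc a b, ∀ k ∈ S, ‖(Φ.flow t z k).2‖ ≤ u) (hub : u * (b - a) ≤ 1 / 4) :
    (∑ᶠ s ∈ collisionTimes (Torus.geometry d) ε (fun t => Φ.flow t z) ∩ Ioc a b,
      ∑ i ∈ S, ∑ j ∈ S,
        (if i ≠ j ∧ ‖(Torus.geometry d).sepVec (Φ.flow s z i).1 (Φ.flow s z j).1‖ = ε then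
          ⟪(Torus.geometry d).sepVec (Φ.flow s z i).1 (Φ.flow s z j).1,
            (Φ.flow s z i).2 - (Φ.flow s z j).2⟫_ℝ else 0)) ≤ S.card * u := by
  have h := stub_eqMomentClusterVirial Φ hz S c hab haut hchart hu hub
  have hGb := abs_clusterVirial_le S c (Φ.flow b z) (hchart b ⟨hab, le_rfl⟩)
  have hGa := abs_clusterVirial_le S c (Φ.flow a z) (hchart a ⟨le_rfl, hab⟩)
  have hvb : ∑ k ∈ S, ‖(Φ.flow b z k).2‖ ≤ S.card * u := by
    have := Finset.sum_le_sum fun k hk => hu b ⟨hab, le_rfl⟩ k hk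
    rwa [Finset.sum_const, nsmul_eq_mul] at this
  have hva : ∑ k ∈ S, ‖(Φ.flow a z k).2‖ ≤ S.card * u := by
    have := Finset.sum_le_sum fun k hk => hu a ⟨le_rfl, hab⟩ k hk
    rwa [Finset.sum_const, nsmul_eq_mul] at this
  rw [abs_le] at hGb hGa
  linarith [hGb.2, hGa.1]

variable {ι : Type*}

/-- **The weighted collision count of an energy block over a short window** (registered sub-goal
`stub_eqMomentClusterBound` of stub `stub_eqMoment`, line `Sketch`, stmt-AtomisticToContinuum-12097):
combine `stub_eqMomentClusterAutonomy` and `stub_eqMomentClusterVirial`.  Let `cl` label the particles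
into blocks, energy-separated at time `a` for the window `[a, b]`
(`d(x_i, x_j) > ε + (b - a)(√(2E_{cl i}) + √(2E_{cl j}))` across blocks), and let the block of `i₀` be
chart-safe at time `a` about `c` with margin: `d(x_k(a), c) + (b - a) √(2E) < 1/4` for its particles,
`2E = Σ_{cl k = cl i₀} ‖v_k(a)‖²`.  Then the collision sum over `(a, b]` of the post-collisional normal
relative velocities of the collisions inside the block is at most `(#block) · √(2E)`: a STATIC
functional of the configuration at the window start, polynomial in the block size. [folklore] -/
theorem stub_eqMomentClusterBound {d : Type*} [Fintype d] {N : ℕ} {ε : ℝ} {ι : Type*}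
    (Φ : HardSphereFlow (Torus.geometry d) ε N) {z : Config N d (UnitAddTorus d)} (hz : z ∈ Φ.good)
    (cl : Fin N → ι) (i₀ : Fin N) (c : UnitAddTorus d) {a b : ℝ} (hab : a ≤ b)
    (hsep : ∀ i j, cl i ≠ cl j →
      ε + (b - a) * (Real.sqrt (∑ k, if cl k = cl i then ‖(Φ.flow a z k).2‖ ^ 2 else 0) +
        Real.sqrt (∑ k, if cl k = cl j then ‖(Φ.flow a z k).2‖ ^ 2 else 0)) <
      Torus.euclidDist (Φ.flow a z i).1 (Φ.flow a z j).1)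
    (hchart₀ : ∀ k, cl k = cl i₀ → Torus.euclidDist (Φ.flow a z k).1 c +
      (b - a) * Real.sqrt (∑ l, if cl l = cl i₀ then ‖(Φ.flow a z l).2‖ ^ 2 else 0) < 1 / 4) :
    (∑ᶠ s ∈ collisionTimes (Torus.geometry d) ε (fun t => Φ.flow t z) ∩ Ioc a b,
      ∑ i ∈ Finset.univ.filter (fun k => cl k = cl i₀), ∑ j ∈ Finset.univ.filter (fun k => cl k = cl i₀),
        (if i ≠ j ∧ ‖(Torus.geometry d).sepVec (Φ.flow s z i).1 (Φ.flow s z j).1‖ = ε then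
          ⟪(Torus.geometry d).sepVec (Φ.flow s z i).1 (Φ.flow s z j).1,
            (Φ.flow s z i).2 - (Φ.flow s z j).2⟫_ℝ else 0)) ≤
    (Finset.univ.filter (fun k => cl k = cl i₀)).card *
      Real.sqrt (∑ l, if cl l = cl i₀ then ‖(Φ.flow a z l).2‖ ^ 2 else 0) := by
  obtain ⟨hC1, -, hC3, -⟩ := stub_eqMomentClusterAutonomy Φ hz cl hsep
  set S : Finset (Fin N) := Finset.univ.filter (fun k => cl k = cl i₀) with hS
  have hmemS : ∀ k, k ∈ S ↔ cl k = cl i₀ := fun k => by simp [hS]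
  -- speeds in the block
  have hu : ∀ t ∈ Icc a b, ∀ k ∈ S, ‖(Φ.flow t z k).2‖ ≤
      Real.sqrt (∑ l, if cl l = cl i₀ then ‖(Φ.flow a z l).2‖ ^ 2 else 0) := by
    intro t ht k hk
    rw [← (hmemS k).1 hk]
    exact hC3 t ht k
  -- autonomy of the block
  have haut : ∀ s ∈ collisionTimes (Torus.geometry d) ε (fun t => Φ.flow t z) ∩ Ioc a b, ∀ i j,
      i ≠ j → Φ.flow s z ∈ contactSet (Torus.geometry d) N ε i j → (i ∈ S ↔ j ∈ S) := by
    intro s hs i j hij hc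
    rw [hmemS, hmemS, hC1 s ⟨hs.1, hs.2.1.le, hs.2.2⟩ i j hij hc]
  -- the chart, and the window length
  have hchart := chart_of_chart_initial Φ hz S c hu fun k hk => by
    rw [mul_comm]; exact hchart₀ k ((hmemS k).1 hk)
  have hub : Real.sqrt (∑ l, if cl l = cl i₀ then ‖(Φ.flow a z l).2‖ ^ 2 else 0) * (b - a) ≤ 1 / 4 := by
    have h0 := hchart₀ i₀ rfl
    have : 0 ≤ Torus.euclidDist (Φ.flow a z i₀).1 c := by
      rw [Torus.euclidDist_eq]; exact norm_nonneg _
    linarith [mul_comm (b - a) (Real.sqrt (∑ l, if cl l = cl i₀ then ‖(Φ.flow a z l).2‖ ^ 2 else 0))]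
  exact clusterCollisionSum_le_card_mul Φ hz S c hab haut hchart hu hub

/-- **The weighted collision count of a window is at most `Σ_i √(2E_{block(i)}(a))`** when every
block is chart-safe.  For a labelling `cl` energy-separated at time `a` (window `[a, b]`) all collisions
in `(a, b]` are intra-block (`stub_eqMomentClusterAutonomy`), so the full ordered collision sum of the
post-collisional normal relative velocities splits over the blocks, and each block contributes at most
`(#block) √(2E_block(a))` (`stub_eqMomentClusterBound`) provided it is within `1/4 - (b - a) √(2E_block)`
of some base point at time `a`; summing, `Σ_blocks (#block) √(2E_block) = Σ_i √(2E_{block(i)})` — a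
STATIC, permutation-invariant functional of the window-start configuration. [folklore] -/
theorem weightedCollisionSum_le_sum_sqrt_blockEnergy {d : Type*} [Fintype d] {N : ℕ} {ε : ℝ}
    {ι : Type*} (Φ : HardSphereFlow (Torus.geometry d) ε N) {z : Config N d (UnitAddTorus d)}
    (hz : z ∈ Φ.good) (cl : Fin N → ι) {a b : ℝ} (hab : a ≤ b)
    (hsep : ∀ i j, cl i ≠ cl j →
      ε + (b - a) * (Real.sqrt (∑ k, if cl k = cl i then ‖(Φ.flow a z k).2‖ ^ 2 else 0) +
        Real.sqrt (∑ k, if cl k = cl j then ‖(Φ.flow a z k).2‖ ^ 2 else 0)) <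
      Torus.euclidDist (Φ.flow a z i).1 (Φ.flow a z j).1)
    (hchart₀ : ∀ i₀, ∃ c : UnitAddTorus d, ∀ k, cl k = cl i₀ → Torus.euclidDist (Φ.flow a z k).1 c +
      (b - a) * Real.sqrt (∑ l, if cl l = cl i₀ then ‖(Φ.flow a z l).2‖ ^ 2 else 0) < 1 / 4) :
    (∑ᶠ s ∈ collisionTimes (Torus.geometry d) ε (fun t => Φ.flow t z) ∩ Ioc a b,
      ∑ i, ∑ j, (if i ≠ j ∧ ‖(Torus.geometry d).sepVec (Φ.flow s z i).1 (Φ.flow s z j).1‖ = ε then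
          ⟪(Torus.geometry d).sepVec (Φ.flow s z i).1 (Φ.flow s z j).1,
            (Φ.flow s z i).2 - (Φ.flow s z j).2⟫_ℝ else 0)) ≤
    ∑ i, Real.sqrt (∑ k, if cl k = cl i then ‖(Φ.flow a z k).2‖ ^ 2 else 0) := by
  have hγ := Φ.isTrajectory z hz
  obtain ⟨hC1, -, -, -⟩ := stub_eqMomentClusterAutonomy Φ hz cl hsep
  have hfin : (collisionTimes (Torus.geometry d) ε (fun t => Φ.flow t z) ∩ Ioc a b).Finite :=
    (hγ.locFinite a b).subset (inter_subset_inter_right _ Ioc_subset_Icc_self)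
  -- abbreviations: the summand, the blocks, the block speed bound
  set F : ℝ → Fin N → Fin N → ℝ := fun s i j =>
    if i ≠ j ∧ ‖(Torus.geometry d).sepVec (Φ.flow s z i).1 (Φ.flow s z j).1‖ = ε then
      ⟪(Torus.geometry d).sepVec (Φ.flow s z i).1 (Φ.flow s z j).1,
        (Φ.flow s z i).2 - (Φ.flow s z j).2⟫_ℝ else 0 with hF
  set S : ι → Finset (Fin N) := fun β => Finset.univ.filter fun k => cl k = β with hS
  set u : ι → ℝ := fun β => Real.sqrt (∑ k, if cl k = β then ‖(Φ.flow a z k).2‖ ^ 2 else 0) with hu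
  -- (1) cross-block terms vanish at the collision times of `(a, b]`
  have hrow : ∀ s ∈ collisionTimes (Torus.geometry d) ε (fun t => Φ.flow t z) ∩ Ioc a b, ∀ i,
      ∑ j, F s i j = ∑ j ∈ S (cl i), F s i j := by
    intro s hs i
    rw [hS, Finset.sum_filter]
    refine Finset.sum_congr rfl fun j _ => ?_
    by_cases hcl : cl j = cl i
    · rw [if_pos hcl]
    · rw [if_neg hcl, hF]
      dsimp only
      rw [if_neg]
      rintro ⟨hij, hn⟩
      exact hcl (hC1 s ⟨hs.1, hs.2.1.le, hs.2.2⟩ i j hij (mem_contactSet.2 ⟨hγ.mem s, hn⟩)).symm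
  -- (2) the per-block bound
  have hblock : ∀ β ∈ Finset.univ.image cl,
      (∑ s ∈ hfin.toFinset, ∑ i ∈ S β, ∑ j ∈ S β, F s i j) ≤ (S β).card * u β := by
    intro β hβ
    obtain ⟨i₀, -, rfl⟩ := Finset.mem_image.1 hβ
    obtain ⟨c, hc⟩ := hchart₀ i₀
    have h := stub_eqMomentClusterBound Φ hz cl i₀ c hab hsep hc
    rw [finsum_mem_eq_finite_toFinset_sum _ hfin] at h
    exact h
  -- (3) bookkeeping: rows are grouped by blocks, and the block sums are summed over the blocks
  calc (∑ᶠ s ∈ collisionTimes (Torus.geometry d) ε (fun t => Φ.flow t z) ∩ Ioc a b, ∑ i, ∑ j, F s i j)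
      = ∑ s ∈ hfin.toFinset, ∑ i, ∑ j ∈ S (cl i), F s i j := by
        rw [finsum_mem_eq_finite_toFinset_sum _ hfin]
        exact Finset.sum_congr rfl fun s hs => Finset.sum_congr rfl fun i _ =>
          hrow s (hfin.mem_toFinset.1 hs) i
    _ = ∑ s ∈ hfin.toFinset, ∑ β ∈ Finset.univ.image cl, ∑ i ∈ S β, ∑ j ∈ S β, F s i j := by
        refine Finset.sum_congr rfl fun s _ => ?_
        rw [← Finset.sum_fiberwise_of_maps_to (fun i _ => Finset.mem_image_of_mem cl (Finset.mem_univ i))]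
        refine Finset.sum_congr rfl fun β _ => Finset.sum_congr rfl fun i hi => ?_
        rw [(Finset.mem_filter.1 hi).2]
    _ = ∑ β ∈ Finset.univ.image cl, ∑ s ∈ hfin.toFinset, ∑ i ∈ S β, ∑ j ∈ S β, F s i j :=
        Finset.sum_comm
    _ ≤ ∑ β ∈ Finset.univ.image cl, (S β).card * u β := Finset.sum_le_sum hblock
    _ = ∑ β ∈ Finset.univ.image cl, ∑ i ∈ S β, u β := by
        refine Finset.sum_congr rfl fun β _ => ?_
        rw [Finset.sum_const, nsmul_eq_mul]
    _ = ∑ i, u (cl i) :=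
        Finset.sum_fiberwise_of_maps_to' (fun i _ => Finset.mem_image_of_mem cl (Finset.mem_univ i)) u

/-- **Sharper form: singleton blocks do not contribute.**  Under the hypotheses of
`weightedCollisionSum_le_sum_sqrt_blockEnergy`, the full ordered collision sum of the window is at most
`Σ_i 𝟙{block(i) is not a singleton} √(2E_{block(i)}(a))` (a block with one particle has no internal
pair, hence no collision term).  This is the static functional whose Gibbs moments are small with the
density: its mean is `O(N · P(block of 1 is not a singleton) · √θ)`. [folklore] -/
theorem weightedCollisionSum_le_sum_sqrt_blockEnergy' {d : Type*} [Fintype d] {N : ℕ} {ε : ℝ}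
    {ι : Type*} (Φ : HardSphereFlow (Torus.geometry d) ε N) {z : Config N d (UnitAddTorus d)}
    (hz : z ∈ Φ.good) (cl : Fin N → ι) {a b : ℝ} (hab : a ≤ b)
    (hsep : ∀ i j, cl i ≠ cl j →
      ε + (b - a) * (Real.sqrt (∑ k, if cl k = cl i then ‖(Φ.flow a z k).2‖ ^ 2 else 0) +
        Real.sqrt (∑ k, if cl k = cl j then ‖(Φ.flow a z k).2‖ ^ 2 else 0)) <
      Torus.euclidDist (Φ.flow a z i).1 (Φ.flow a z j).1)
    (hchart₀ : ∀ i₀, ∃ c : UnitAddTorus d, ∀ k, cl k = cl i₀ → Torus.euclidDist (Φ.flow a z k).1 c +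
      (b - a) * Real.sqrt (∑ l, if cl l = cl i₀ then ‖(Φ.flow a z l).2‖ ^ 2 else 0) < 1 / 4) :
    (∑ᶠ s ∈ collisionTimes (Torus.geometry d) ε (fun t => Φ.flow t z) ∩ Ioc a b,
      ∑ i, ∑ j, (if i ≠ j ∧ ‖(Torus.geometry d).sepVec (Φ.flow s z i).1 (Φ.flow s z j).1‖ = ε then
          ⟪(Torus.geometry d).sepVec (Φ.flow s z i).1 (Φ.flow s z j).1,
            (Φ.flow s z i).2 - (Φ.flow s z j).2⟫_ℝ else 0)) ≤
    ∑ i, (if (Finset.univ.filter fun k => cl k = cl i).card = 1 then 0 else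
      Real.sqrt (∑ k, if cl k = cl i then ‖(Φ.flow a z k).2‖ ^ 2 else 0)) := by
  have hγ := Φ.isTrajectory z hz
  obtain ⟨hC1, -, -, -⟩ := stub_eqMomentClusterAutonomy Φ hz cl hsep
  have hfin : (collisionTimes (Torus.geometry d) ε (fun t => Φ.flow t z) ∩ Ioc a b).Finite :=
    (hγ.locFinite a b).subset (inter_subset_inter_right _ Ioc_subset_Icc_self)
  set F : ℝ → Fin N → Fin N → ℝ := fun s i j =>
    if i ≠ j ∧ ‖(Torus.geometry d).sepVec (Φ.flow s z i).1 (Φ.flow s z j).1‖ = ε then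
      ⟪(Torus.geometry d).sepVec (Φ.flow s z i).1 (Φ.flow s z j).1,
        (Φ.flow s z i).2 - (Φ.flow s z j).2⟫_ℝ else 0 with hF
  set S : ι → Finset (Fin N) := fun β => Finset.univ.filter fun k => cl k = β with hS
  set u : ι → ℝ := fun β => if (S β).card = 1 then 0 else
    Real.sqrt (∑ k, if cl k = β then ‖(Φ.flow a z k).2‖ ^ 2 else 0) with hu
  have hrow : ∀ s ∈ collisionTimes (Torus.geometry d) ε (fun t => Φ.flow t z) ∩ Ioc a b, ∀ i,
      ∑ j, F s i j = ∑ j ∈ S (cl i), F s i j := by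
    intro s hs i
    rw [hS, Finset.sum_filter]
    refine Finset.sum_congr rfl fun j _ => ?_
    by_cases hcl : cl j = cl i
    · rw [if_pos hcl]
    · rw [if_neg hcl, hF]
      dsimp only
      rw [if_neg]
      rintro ⟨hij, hn⟩
      exact hcl (hC1 s ⟨hs.1, hs.2.1.le, hs.2.2⟩ i j hij (mem_contactSet.2 ⟨hγ.mem s, hn⟩)).symm
  -- the per-block bound, singleton blocks contributing nothing
  have hblock : ∀ β ∈ Finset.univ.image cl,
      (∑ s ∈ hfin.toFinset, ∑ i ∈ S β, ∑ j ∈ S β, F s i j) ≤ (S β).card * u β := by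
    intro β hβ
    obtain ⟨i₀, -, rfl⟩ := Finset.mem_image.1 hβ
    by_cases h1 : (S (cl i₀)).card = 1
    · -- a singleton block `{i₀}`: only the diagonal term, which vanishes
      obtain ⟨k₀, hk₀⟩ := Finset.card_eq_one.1 h1
      have hzero : ∀ s, ∑ i ∈ S (cl i₀), ∑ j ∈ S (cl i₀), F s i j = 0 := fun s => by
        rw [hk₀, Finset.sum_singleton, Finset.sum_singleton, hF]
        exact if_neg fun h => h.1 rfl
      simp only [hzero, Finset.sum_const_zero, hu, h1, if_true, mul_zero, le_refl]
    · obtain ⟨c, hc⟩ := hchart₀ i₀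
      have h := stub_eqMomentClusterBound Φ hz cl i₀ c hab hsep hc
      rw [finsum_mem_eq_finite_toFinset_sum _ hfin] at h
      simp only [hu, h1, if_false]
      exact h
  calc (∑ᶠ s ∈ collisionTimes (Torus.geometry d) ε (fun t => Φ.flow t z) ∩ Ioc a b, ∑ i, ∑ j, F s i j)
      = ∑ s ∈ hfin.toFinset, ∑ i, ∑ j ∈ S (cl i), F s i j := by
        rw [finsum_mem_eq_finite_toFinset_sum _ hfin]
        exact Finset.sum_congr rfl fun s hs => Finset.sum_congr rfl fun i _ =>
          hrow s (hfin.mem_toFinset.1 hs) i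
    _ = ∑ s ∈ hfin.toFinset, ∑ β ∈ Finset.univ.image cl, ∑ i ∈ S β, ∑ j ∈ S β, F s i j := by
        refine Finset.sum_congr rfl fun s _ => ?_
        rw [← Finset.sum_fiberwise_of_maps_to (fun i _ => Finset.mem_image_of_mem cl (Finset.mem_univ i))]
        refine Finset.sum_congr rfl fun β _ => Finset.sum_congr rfl fun i hi => ?_
        rw [(Finset.mem_filter.1 hi).2]
    _ = ∑ β ∈ Finset.univ.image cl, ∑ s ∈ hfin.toFinset, ∑ i ∈ S β, ∑ j ∈ S β, F s i j :=
        Finset.sum_comm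
    _ ≤ ∑ β ∈ Finset.univ.image cl, (S β).card * u β := Finset.sum_le_sum hblock
    _ = ∑ β ∈ Finset.univ.image cl, ∑ i ∈ S β, u β := by
        refine Finset.sum_congr rfl fun β _ => ?_
        rw [Finset.sum_const, nsmul_eq_mul]
    _ = ∑ i, u (cl i) :=
        Finset.sum_fiberwise_of_maps_to' (fun i _ => Finset.mem_image_of_mem cl (Finset.mem_univ i)) u

end Bound

end Summit.AtomisticToContinuum.HydrodynamicLimit.Theorems.ContactAngleEquidistributionSketch

end
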